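import Summits.BirchSwinnertonDyer.BirchSwinnertonDyer.Theorems.AdditiveKolyvaginRoadLevelKolyvaginSystemsAdditiveIffKolyvaginPrimitive
import HarnessLib

/-!
# Route `AdditiveKolyvaginRoad`, crux KS′ `LevelKolyvaginSystemsAdditive` (item stmt-BirchSwinnertonDyer-21396):
# KS′ on the GOOD-AVATAR LOCUS of line `epsilon_matched_retyping` from THREE named inputs — Kriz–Li Thm. 1.16, PUB, DUAL —
# with NO displayed E-side binder and NO W. Zhang datum
# (cell `pub/bsd-wall`, width seat `bsd-wall-akr-p2x-w3` g8; `--supports stmt-BirchSwinnertonDyer-21396`, helper; = width seat akr-p2x-w2's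
# `levelKolyvaginSystemsAdditive_onGoodAvatarLocus_of_twin` (p626643 §3) with its one displayed binder (Twin) DISCHARGED through the lead's
# frame-wise socket `nonempty_levelKolyvaginSystemP_of_kolyvaginClass_ne_zero_of_published` (p629856))

WHY. The registered skeleton v9 of the line (`Cruxes/LevelKolyvaginSystemsAdditive/Lines/epsilon_matched_retyping.lean`) closes KS′ on its
on-locus branch from `stub_publishedInputsEpsilon` = SIX named facts (`p`-parity for all curves and primes, Cassels–Tate over `ℚ`, Poitou–Tate
over `ℚ`, Kriz–Li Thm. 1.16, PUB, DUAL) plus a displayed level-raised bipartite datum. After the capstone `KS′ ⟺ KPA′ mod PUB ∕ DUAL`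
(p629856) the on-locus branch needs only the SEED — KPA′'s conclusion at the frame, which on the good-avatar locus is Kriz–Li's transfer
(`kolyvaginPrimitiveAdditive_conclusion_on_gammaLocus`, conductor one) — and the two route bundles. THIS FILE records that reading as one
theorem, so that the lead can cut the on-locus named inputs of the skeleton to {Kriz–Li 1.16, PUB, DUAL}.

WHAT. `levelKolyvaginSystemsAdditive_onGoodAvatarLocus_of_published` — at a ♯ rank-one additive frame of the route carrying a GOOD (ordinary or
supersingular) NON-ANOMALOUS avatar `E₀` (`Γ_ℚ`-iso `E[p] ≃ E₀[p]`, ♠(1) for `E₀`, `rad(pN) = rad(pN₀)`, same multiplicative primes, Heegner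
for `N₀`, a parametrisation `Dt₀` with `p ∤ c(Dt₀)`) and the LOG CERTIFICATE «some Heegner point of `E₀` over `heegnerPointComplex Dt₀ H₀` is not
`p`-divisible in `E₀(ℚ_p)`» — the locus of p626643 §3 VERBATIM — `Nonempty (LevelKolyvaginSystemP W K p Dt β ι c)` for every `c ≠ 1` and every
`ZMod p`-structure, GRANTED ONLY `KrizLi2019.thm116_padicLogHeegner_congruence`, `PublishedInputsAdditiveKoly`, `PublishedDualityInputsAdditiveKoly`.

HONEST FRAMING: one theorem; 0 definitions, 0 named facts introduced, 0 `sorry`; CONDITIONAL on the three displayed named inputs (hypotheses).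
A frame-by-frame (certificate) result, not a class-wide one; closes nothing. BSD is not proved by any of this; KS′ ⟺ KPA′ is OPEN off the locus.

References: [cite: KrizLi2019, Thm. 1.16, Rem. 1.17] [cite: WZhang2014, Thm. 4.3, Thm. 7.2, §8.1, §9] [cite: Howard2004HeegnerKolyvagin, Lemma 2.5.3,
Lemma 2.6.4] [cite: McCallumLMS1991, Cor. 3.2] [cite: GrossLMS1991, §4 (4.4)].
-/

set_option linter.dupNamespace false -- single-conjunct summit repeats the name by design

noncomputable section

open scoped Classical

namespace Summit.BirchSwinnertonDyer.BirchSwinnertonDyer.Theorems.AdditiveKoly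

open WeierstrassCurve NumberField IsDedekindDomain Field
  Literature.NumberTheory.EllipticCurves Literature.NumberTheory.EllipticCurves.ModularForms
  Literature.NumberTheory.EllipticCurves.Rank1Residual Literature.NumberTheory.GaloisRepresentations Module
  Summit.BirchSwinnertonDyer.Rank1Residual.X11b.Three.Koly
  Summit.BirchSwinnertonDyer.BirchSwinnertonDyer.Theses.AdditiveKolyvaginRoad
  Summit.BirchSwinnertonDyer.Rank1Residual

/-- **KS′ ON THE GOOD-AVATAR LOCUS from Kriz–Li Thm. 1.16, PUB and DUAL alone.** Frame: a ♯ rank-one additive frame of the route (`p ≥ 5`,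
`Addv`, `ρ̄` onto, ♠(1), ♠(2), `p ∤ ∏c`, `r_an = 1`, `K` imaginary quadratic with `d_K` odd `< −4`, Heegner for `N_E`, `L(E^{d_K}, 1) ≠ 0`,
`4N ∣ β² − d_K`, `p ∤ c(Dt)`). Locus (verbatim the one of `levelKolyvaginSystemsAdditive_onGoodAvatarLocus_of_twin`): a GOOD NON-ANOMALOUS avatar
`E₀ = W₀` (`Γ_ℚ`-equivariant `E[p] ≃ E₀[p]`, ♠(1) for `E₀`, `rad(pN) = rad(pN₀)`, same multiplicative primes, Heegner for `N₀`, `p ∤ c(Dt₀)`) with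
the LOG CERTIFICATE at `p`. Conclusion: `Nonempty (LevelKolyvaginSystemP W K p Dt β ι c)` for every complex conjugation `c ≠ 1` and every
`ZMod p`-structure on `H¹(K, E[p])`. Proof: sign agreement at the multiplicative primes (`sign_agreement_of_torsionCongr`) ⟹ the Kriz–Li SEED
`kolyvaginPrimitiveAdditive_conclusion_on_gammaLocus` (KPA′ at the frame, conductor one) ⟹ the lead's frame-wise socket
`nonempty_levelKolyvaginSystemP_of_kolyvaginClass_ne_zero_of_published` (PUB + DUAL; (Twin) a theorem). CONDITIONAL on the three named inputs.
[cite: KrizLi2019, Thm. 1.16] [cite: WZhang2014, Thm. 4.3, §9] [cite: Howard2004HeegnerKolyvagin, Lemma 2.5.3] -/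
theorem levelKolyvaginSystemsAdditive_onGoodAvatarLocus_of_published (hKL : KrizLi2019.thm116_padicLogHeegner_congruence)
    (hPUB : PublishedInputsAdditiveKoly) (hDual : PublishedDualityInputsAdditiveKoly)
    (W : WeierstrassCurve ℚ) [W.IsElliptic] [W.IsGloballyMinimal] [NeZero (W.conductorNorm ℤ)]
    (p : ℕ) [Fact p.Prime] (K : Type) [Field K] [NumberField K]
    (Dt : ModularParametrizationData W (W.conductorNorm ℤ)) (β : ℤ) (ι : K →+* ℂ)
    (hp : 5 ≤ p) (hadd : Addv W p) (hs : W.HasSurjectiveModNGaloisRep p)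
    (hsp : ∀ (ℓ : ℕ) [Fact ℓ.Prime], W.HasMultiplicativeReductionAtPrime ℓ → ¬ p ∣ padicValInt ℓ W.minimalDiscriminantInt)
    (htwo : ∃ (ℓ₁ ℓ₂ : ℕ) (_ : Fact ℓ₁.Prime) (_ : Fact ℓ₂.Prime), ℓ₁ ≠ ℓ₂ ∧
      W.HasMultiplicativeReductionAtPrime ℓ₁ ∧ W.HasMultiplicativeReductionAtPrime ℓ₂)
    (htam : ¬ p ∣ W.tamagawaProduct) (hr : W.analyticRank = 1) (hK : IsImaginaryQuadratic K) (hodd : Odd (NumberField.discr K))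
    (hlt : NumberField.discr K < -4) (hH : SatisfiesHeegnerHypothesis (W.conductorNorm ℤ) K)
    (hL : (W.quadraticTwist (NumberField.discr K : ℚ)).entireLFunction 1 ≠ 0)
    (hβ : (4 * (W.conductorNorm ℤ : ℤ)) ∣ β ^ 2 - NumberField.discr K) (hc : ¬ (p : ℤ) ∣ Dt.c)
    (hav : ∃ (W₀ : WeierstrassCurve ℚ) (_ : W₀.IsElliptic) (_ : W₀.IsGloballyMinimal) (_ : NeZero (W₀.conductorNorm ℤ))
      (Dt₀ : ModularParametrizationData W₀ (W₀.conductorNorm ℤ)) (e : geomTorsion W (p : ℤ) ≃+ geomTorsion W₀ (p : ℤ)),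
      (∀ (σ : absoluteGaloisGroup ℚ) (P : geomTorsion W (p : ℤ)), e (σ • P) = σ • e P) ∧
      W₀.HasGoodReductionAtPrime p ∧ ¬ (p : ℤ) ∣ W₀.frobeniusTrace p - 1 ∧
      (∀ (ℓ : ℕ) [Fact ℓ.Prime], W₀.HasMultiplicativeReductionAtPrime ℓ →
        ¬ p ∣ padicValInt ℓ W₀.minimalDiscriminantInt) ∧
      (∀ q : ℕ, q.Prime → (q ∣ p * W.conductorNorm ℤ ↔ q ∣ p * W₀.conductorNorm ℤ)) ∧
      (∀ (ℓ : ℕ) [Fact ℓ.Prime], W.HasMultiplicativeReductionAtPrime ℓ ↔ W₀.HasMultiplicativeReductionAtPrime ℓ) ∧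
      SatisfiesHeegnerHypothesis (W₀.conductorNorm ℤ) K ∧ ¬ (p : ℤ) ∣ Dt₀.c ∧
      ∃ (ιp : K →+* ℚ_[p]) (H₀ : HeegnerDatum (W₀.conductorNorm ℤ) (NumberField.discr K))
        (y₀ : (W₀.baseChange K).toAffine.Point),
        WeierstrassCurve.Affine.Point.map ι.toRatAlgHom y₀ = heegnerPointComplex Dt₀ H₀ ∧
          ¬ ∃ Q : (W₀.baseChange ℚ_[p]).toAffine.Point, (p : ℤ) • Q = X11b.padicPointOf W₀ p ιp y₀) :
    ∀ (c : K ≃ₐ[ℚ] K), c ≠ 1 → ∀ [Module (ZMod p) (Vp W K p)], Nonempty (LevelKolyvaginSystemP W K p Dt β ι c) := by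
  obtain ⟨W₀, _, _, _, Dt₀, e, he, hgood₀, hna, hsp₀, hrad, htype, hH₀, hc₀, ιp, hcert⟩ := hav
  -- sign agreement at the multiplicative primes is automatic (Tate curve + torsion congruence)
  have hsign : ∀ (ℓ : ℕ) [Fact ℓ.Prime], W₀.HasMultiplicativeReductionAtPrime ℓ → W.LFunction ℓ = W₀.LFunction ℓ :=
    sign_agreement_of_torsionCongr W W₀ p hp hadd hsp₀ htype e he
  -- the SEED (KPA′ at this frame, by Kriz–Li at conductor one) fed into the frame-wise socket (PUB + DUAL; (Twin) a theorem)
  exact nonempty_levelKolyvaginSystemP_of_kolyvaginClass_ne_zero_of_published hPUB hDual W p K Dt β ι hp hadd hs hsp htwo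
    htam hr hK hodd hlt hH hL hβ hc
    (kolyvaginPrimitiveAdditive_conclusion_on_gammaLocus W p K Dt β ι hKL hp hadd hs hK hlt hH hβ hc
      W₀ e he hgood₀ hna hrad htype hsign Dt₀ hc₀ hH₀ ιp hcert)

end Summit.BirchSwinnertonDyer.BirchSwinnertonDyer.Theorems.AdditiveKoly

end
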